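import Summits.PneNP.PneNP.Theorems.ConvexRankGatesCaptureDualSDP
import Summits.PneNP.PneNP.Theorems.ConvexRankGatesConvexGateBlindCollapseMain
import HarnessLib

/-!
# Crux `Capture` (stmt-PneNP-2659) — duality audit, cell D7 (circuit form): polynomial
# `{∧₂, ∨₂} ∪ CONV` circuits are CLOSED under Boolean duality, with a ONE-gate normal form

Combining the single-gate collapse of `{∧₂, ∨₂} ∪ CONV_s` circuits (`exists_oneConvGate_of_isOver`,
`ConvexRankGatesConvexGateBlindCollapseMain.lean`, crux #2) with the closure of the CONV class under Boolean
duality (`isConvGate_bdual`, `ConvexRankGatesCaptureDualSDP.lean`, this audit): the Boolean dual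
`x ↦ ¬ C(¬ x)` of every circuit `C` with `t` gates over `{∧₂, ∨₂} ∪ CONV_s` on `n` inputs is computed by a
circuit with ONE gate over `CONV_{48 (s+3)² (t+n+1)⁴}` (`exists_oneConvGateCircuit_bdual`). So for the convex
door alone the duality test of `Capture` is passed uniformly, and for crux #2 (`ConvexGateBlind`) a lower bound
against `{∧,∨,CONV}`-circuits for a monotone `f` is the same problem as for its dual `f^d`. The re-wiring
lemma `IsConvGate.rewire` (summing the columns of `B` over the fibres of the wiring) normalises the arity of a
CONV gate to the number of circuit inputs. [folklore]
-/

namespace Summit.PneNP.PneNP.Theorems.Capture.DualityAudit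

set_option linter.dupNamespace false -- `Summit.PneNP.PneNP.…`: summit = sub-problem (D-0017)

open Literature.Computability.Complexity Finset Matrix
open Summit.PneNP.PneNP.Theorems (exists_oneConvGate_of_isOver)

noncomputable section

/-- **Re-wiring a CONV gate**: if `g` (arity `m`) is a CONV gate of width `s` and `w : Fin m → Fin n` is a
wiring, then `y ↦ g (y ∘ w)` (arity `n`) is a CONV gate of the same width — sum the columns of `B` over the
fibres of `w`. [folklore] -/
theorem IsConvGate.rewire {s m n : ℕ} {g : (Fin m → Bool) → Bool} (hg : IsConvGate s ⟨m, g⟩)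
    (w : Fin m → Fin n) : IsConvGate s ⟨n, fun y => g (fun a => y (w a))⟩ := by
  classical
  obtain ⟨p, q, hpq, A, b, B, hB, hgv⟩ := hg
  refine ⟨p, q, hpq, A, b, fun i k => ∑ a ∈ Finset.univ.filter (fun a => w a = k), B i a,
    fun i k => Finset.sum_nonneg fun a _ => hB i a, fun y => ?_⟩
  show g (fun a => y (w a)) = true ↔ _
  rw [hgv]
  have hsum : ∀ i, ∑ a, B i a * (if y (w a) then (1 : ℝ) else 0) =
      ∑ k, (∑ a ∈ Finset.univ.filter (fun a => w a = k), B i a) * (if y k then (1 : ℝ) else 0) := by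
    intro i
    rw [← Finset.sum_fiberwise_of_maps_to (s := Finset.univ) (t := Finset.univ) (g := w)
      (fun a _ => Finset.mem_univ (w a))]
    refine Finset.sum_congr rfl fun k _ => ?_
    rw [Finset.sum_mul]
    refine Finset.sum_congr rfl fun a ha => ?_
    rw [(Finset.mem_filter.1 ha).2]
  simp only [hsum]

/-- Size bookkeeping: `2W² + 3W + 2n + 2 ≤ 3W²` for the collapse width `W = 4(s+3)(t+n+1)²`. [folklore] -/
theorem dual_width_le (s t n : ℕ) :
    2 * ((4 * (s + 3) * (t + n + 1) ^ 2) * (4 * (s + 3) * (t + n + 1) ^ 2)) +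
      3 * (4 * (s + 3) * (t + n + 1) ^ 2) + 2 * n + 2 ≤ 48 * (s + 3) ^ 2 * (t + n + 1) ^ 4 := by
  set M := t + n + 1 with hM
  have hM1 : 1 ≤ M := by omega
  have hn : n + 1 ≤ M := by omega
  have hM2 : M ≤ M ^ 2 := by nlinarith
  have hW : 12 ≤ 4 * (s + 3) * M ^ 2 := by nlinarith
  set W := 4 * (s + 3) * M ^ 2 with hWdef
  have h1 : 2 * n + 2 ≤ 2 * W := by nlinarith
  have h2 : 3 * W + 2 * n + 2 ≤ W * W := by nlinarith
  have h3 : W * W = 16 * (s + 3) ^ 2 * M ^ 4 := by rw [hWdef]; ring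
  nlinarith

/-- **Polynomial `{∧₂, ∨₂} ∪ CONV` circuits are closed under Boolean duality, with a ONE-gate normal form**:
the dual `x ↦ ¬ C(¬ x)` of a circuit `C` with `t` gates over `{∧₂, ∨₂} ∪ CONV_s` on `n` inputs is computed by
a circuit with one gate over `CONV_{48 (s+3)² (t+n+1)⁴}` (collapse to one CONV gate, re-wire to arity `n`,
dualise the gate, wire it back). [folklore] -/
theorem exists_oneConvGateCircuit_bdual : ∀ (ι : Type) [Fintype ι] (s : ℕ) (C : Circuit ι),
    C.IsOver ({GateFn.and 2, GateFn.or 2} ∪ {g | IsConvGate s g}) →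
    ∃ C₁ : Circuit ι,
      C₁.IsOver {g | IsConvGate (48 * (s + 3) ^ 2 * (C.size + Fintype.card ι + 1) ^ 4) g} ∧
      C₁.size ≤ 1 ∧ ∀ x, C₁.eval x = !C.eval (fun i => !x i) := by
  intro ι _ s C hC
  classical
  obtain ⟨g, hg, w, hw⟩ := exists_oneConvGate_of_isOver C hC
  set n := Fintype.card ι with hn
  set W := 4 * (s + 3) * (C.size + Fintype.card ι + 1) ^ 2 with hW
  let eι := Fintype.equivFin ι
  -- the collapsed gate, re-wired to arity `n`
  let g₀ : (Fin n → Bool) → Bool := fun y => g.2 fun a => y (eι (w a))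
  have hg₀ : IsConvGate W ⟨n, g₀⟩ := IsConvGate.rewire (g := g.2) hg fun a => eι (w a)
  -- its Boolean dual is a CONV gate again
  have hd := isConvGate_bdual hg₀
  have hd' : IsConvGate (48 * (s + 3) ^ 2 * (C.size + Fintype.card ι + 1) ^ 4)
      ⟨n, fun y => !g₀ (fun k => !y k)⟩ :=
    hd.mono (by simpa [hW] using dual_width_le s C.size (Fintype.card ι))
  -- wire the dual gate back to the inputs
  obtain ⟨C₁, h₁, hs₁, he₁⟩ :=
    (CktSize.gate (B := {g | IsConvGate (48 * (s + 3) ^ 2 * (C.size + Fintype.card ι + 1) ^ 4) g})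
      ⟨n, fun y => !g₀ (fun k => !y k)⟩ hd' (fun k => eι.symm k)).toCircuit
  refine ⟨C₁, h₁, hs₁, fun x => ?_⟩
  rw [he₁ x, ← hw (fun i => !x i)]
  simp [g₀]

end

end Summit.PneNP.PneNP.Theorems.Capture.DualityAudit
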